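import Summits.CriticalPhenomena.PercolationContinuityZ3.Theorems.PercNearOneGluingNoHeavyQuantFarSunSharpLayerThreeB
import Summits.CriticalPhenomena.PercolationContinuityZ3.Theorems.PercNearOneGluingNoHeavyQuantFarSunSharpLayerFourFive
import Summits.CriticalPhenomena.PercolationContinuityZ3.Theorems.PercNearOneGluingNoHeavyQuantFarSunLayerTwo
import Summits.CriticalPhenomena.PercolationContinuityZ3.Theorems.PercNearOneGluingNoHeavyQuantFarSunTKFinalAllK
import Summits.CriticalPhenomena.PercolationContinuityZ3.Theorems.PercNearOneGluingNoHeavyQuantFarSunRowLeEleven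
import HarnessLib

/-!
# FAR beyond trees: THE STATE OF FAR ON HAIRY CYCLES IN ONE THEOREM (2026-08-26) — `HairyCycle.sunFAR_of_known`

builds on p205010 (kernel theorem, internal audit signed; external expert review pending)

Support file (`--supports stmt-CriticalPhenomena-4575`), seat `prim-cert-1` (gen 42); memo `prim-cert-1/FROM-prim-cert-1-g42-SHARP-LARGEK.md` §0.
Assembly only (no new mathematics): `SunFAR K j` — FAR at layer `j` on the sun graph with `K ≥ 2` hairs, all weights — holds whenever
`j ≤ 2` (`sunFAR_zero`, `sunFAR_one`, `sunFAR_two_all`) or `K ≤ 11` (`sunFAR_of_le_eleven`, the sun certificates) or `17j + 68 ≤ K` (`sunFAR_of_ge_sharp`) or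
`(j, K) ∈ {3} × [83, ∞) ∪ {4} × [102, ∞) ∪ {5} × [112, ∞)` (`sunFAR_three_of_ge_eightythree`, `sunFAR_four_of_ge`, `sunFAR_five_of_ge`):
* **`HairyCycle.sunFAR_of_known`**;  `HairyCycle.sunFAR_of_ge_sharp_all` — for EVERY layer `j` and `K ≥ 17j + 68`;
* graph forms `farRelayRow_hairyCycle_of_known`, `farRelayRow_ring_of_known` (the body of `Quant.FarRelayRow` on every hairy cycle / ring in these ranges).
What remains open on hairy cycles: `12 ≤ K ≤ 82` at layer 3, `12 ≤ K ≤ 101` at layer 4, `12 ≤ K ≤ 111` at layer 5, `12 ≤ K ≤ 17j+67` at layers `j ≥ 6`.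
No definitions, no sorries, standard axioms (plus the certificate axioms of the `K ≤ 11` kernel certificates it imports).  [this work]
[cite: KozmaNitzan2024, Lemma 2 (p. 6), Conjecture 3 (p. 15)] (context: the lower-tail family FAR serves).
-/

noncomputable section

namespace Summit.CriticalPhenomena.PercolationContinuityZ3.Theorems.HairyCycle

open Finset
open scoped Classical

/-- **FAR at EVERY layer for `K ≥ 17j + 68`** (layers `0, 1` hold for all `K ≥ 2`). [this work] -/
theorem sunFAR_of_ge_sharp_all (j : ℕ) {K : ℕ} (hK : 17 * j + 68 ≤ K) : SunFAR K j := by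
  have hK2 : 2 ≤ K := by omega
  rcases Nat.lt_or_ge j 2 with hj | hj
  · interval_cases j
    · exact sunFAR_zero hK2
    · exact sunFAR_one hK2
  · exact sunFAR_of_ge_sharp hj hK

/-- **THE STATE OF FAR ON HAIRY CYCLES (2026-08-26).**  For `K ≥ 2` hairs and a layer `j`, `SunFAR K j` holds whenever `j ≤ 2`, or `K ≤ 11`, or `17j + 68 ≤ K`,
or `j = 3 ∧ 83 ≤ K`, or `j = 4 ∧ 102 ≤ K`, or `j = 5 ∧ 112 ≤ K`. [this work] -/
theorem sunFAR_of_known {K j : ℕ} (hK2 : 2 ≤ K)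
    (h : j ≤ 2 ∨ K ≤ 11 ∨ 17 * j + 68 ≤ K ∨ (j = 3 ∧ 83 ≤ K) ∨ (j = 4 ∧ 102 ≤ K) ∨ (j = 5 ∧ 112 ≤ K)) : SunFAR K j := by
  rcases h with hj | hK | hK | ⟨rfl, hK⟩ | ⟨rfl, hK⟩ | ⟨rfl, hK⟩
  · interval_cases j
    · exact sunFAR_zero hK2
    · exact sunFAR_one hK2
    · exact sunFAR_two_all hK2
  · exact sunFAR_of_le_eleven hK2 hK j
  · exact sunFAR_of_ge_sharp_all j hK
  · exact sunFAR_three_of_ge_eightythree hK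
  · exact sunFAR_four_of_ge hK
  · exact sunFAR_five_of_ge hK

/-! ## Graph forms -/

open MeasureTheory
open Literature.Probability.Percolation Literature.Probability.LatticeModels
open Summit.CriticalPhenomena.PercolationContinuityZ3.Theorems.TwoCopy

/-- **FAR on every hairy cycle in the known ranges** (`K ≥ 2` pendant relays, layer `j`; all weights). [this work] -/
theorem farRelayRow_hairyCycle_of_known {n L K : ℕ} {cyc : ℕ → Fin n} {base : ℕ → ℕ} {tip : ℕ → Fin n} (H : IsHairyCycle L cyc K base tip)
    {j : ℕ} (hK2 : 2 ≤ K) (h : j ≤ 2 ∨ K ≤ 11 ∨ 17 * j + 68 ≤ K ∨ (j = 3 ∧ 83 ≤ K) ∨ (j = 4 ∧ 102 ≤ K) ∨ (j = 5 ∧ 112 ≤ K))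
    (w : Sym2 (Fin n) → unitInterval)
    (hsupp : ∀ e : Sym2 (Fin n), ¬ e.IsDiag → w e ≠ 0 →
      (∃ i, i < L ∧ e = cycE L cyc i) ∨ (∃ k, k < K ∧ e = hairE cyc base tip k))
    (t : ℝ)
    (hEN : (2 * j : ℝ) < ∑ a ∈ (Finset.range K).image tip, (prodBernoulli w).real (openConn (cyc 0) a))
    (hcut : ∀ a ∈ (Finset.range K).image tip, (prodBernoulli w).real (openConn (cyc 0) a)ᶜ ≤ t) :
    (prodBernoulli w).real {ω : BondConfig (Fin n) |
      (((Finset.range K).image tip).filter fun a => ω ∈ openConn (cyc 0) a).card ≤ j} ≤ t :=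
  farRelayRow_hairyCycle_of_sunFAR H (sunFAR_of_known hK2 h) w hsupp t hEN hcut

/-- **FAR on every RING in the known ranges** (relays at cycle vertices and/or on pendant hairs; weights on the cycle and proper hair edges). [this work] -/
theorem farRelayRow_ring_of_known {n L K : ℕ} {cyc : ℕ → Fin n} {base : ℕ → ℕ} {tip : ℕ → Fin n} (H : IsHairyCycleD L cyc K base tip)
    {j : ℕ} (hK2 : 2 ≤ K) (h : j ≤ 2 ∨ K ≤ 11 ∨ 17 * j + 68 ≤ K ∨ (j = 3 ∧ 83 ≤ K) ∨ (j = 4 ∧ 102 ≤ K) ∨ (j = 5 ∧ 112 ≤ K))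
    (w : Sym2 (Fin n) → unitInterval)
    (hsupp : ∀ e : Sym2 (Fin n), ¬ e.IsDiag → w e ≠ 0 →
      (∃ i, i < L ∧ e = cycE L cyc i) ∨ (∃ k, k < K ∧ e = hairE cyc base tip k))
    (t : ℝ)
    (hEN : (2 * j : ℝ) < ∑ a ∈ (Finset.range K).image tip, (prodBernoulli w).real (openConn (cyc 0) a))
    (hcut : ∀ a ∈ (Finset.range K).image tip, (prodBernoulli w).real (openConn (cyc 0) a)ᶜ ≤ t) :
    (prodBernoulli w).real {ω : BondConfig (Fin n) |
      (((Finset.range K).image tip).filter fun a => ω ∈ openConn (cyc 0) a).card ≤ j} ≤ t :=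
  farRelayRow_ring_of_sunFAR H (sunFAR_of_known hK2 h) w hsupp t hEN hcut

end Summit.CriticalPhenomena.PercolationContinuityZ3.Theorems.HairyCycle

end
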